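import Summits.Ventures.Crystal3D.Theorems.StickyWulffConstantCoaxialWallLawCapCheckerPinPolygon
import HarnessLib

/-!
# Soundness lemma (L5), the PAIR rule, for the certificate checker `capcc` (crux `CoaxialWallLaw`, stmt-Ventures-19481)

HONEST FRAMING. Venture `Summits/Ventures/Crystal3D` (cell `crystal3d-full`); helper `--supports` the crux `CoaxialWallLaw`
(stmt-Ventures-19481, `route-Ventures-StickyWulffConstant`), registered line 'CoaxialWallLawCertificates' (planner cf-p1, stub
`stub_lensCert`); fourth file of the checker-soundness series ('…CapCheckerLemmas' (L1)(L2), '…CapCheckerCoverLemmas' (L3)(L4)(LK),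
'…CapCheckerPinPolygon' (finite pin certificate)).  SOURCE: cf-p2's certificate schema v1, PREREG (69.0⁷) S-2 `PairCert`/`KappaCert`
CHECK R1 and S-3 (L5); cf-p1 DECISIONS (cliv)(2), (clv).
SETTING.  Two ADJACENT forbidden slot directions `e, e₂` (unit, `⟪e, e₂⟫ = ½`) of a member, a radius `ρ > 0`, and the cones
`cone(e, ρ) = {u : ⟪u, e⟫ > 0, ‖u‖² ≤ (1 + ρ²)⟪u, e⟫²}` (angle `≤ arctan ρ`).  Blockers ACTIVE at `e` (`⟪e, w⟫ = ‖w‖²/2`) constrain the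
directions in which a witness near `e` can be displaced: in gnomonic coordinates `u/⟪u, e⟫ = e + T`, `T ⊥ e`, `‖T‖ ≤ ρ`, activeness and
`√(1 + x²) ≤ 1 + x²/2` give `⟪T, w⟫ ≤ ρ‖w‖²‖T‖/4` («`T` is `ρ`-feasible»).  The KAPPA hypothesis (support form of R1) says every `ρ`-feasible
tangent `T` at `e` points towards `e₂`: `κ‖T‖ ≤ ⟪T, e₂ − ½e⟫`; symmetrically at `e₂` with `κ'`.
* `pair_arith` — the real core: `0 ≤ x, y ≤ ρ`, `x + y > 0`, `κ, κ' > 3ρ/4 + ρ³/16` ⇒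
  `½ + κx + κ'y − xy > ½(1 + x²/2)(1 + y²/2) ≥ ½√(1 + x²)√(1 + y²)`.
* `gnomonic_tangent` — the decomposition `⟪u, e⟫⁻¹u = e + T` (`T ⊥ e`, `‖T‖² = ⟪u, e⟫⁻² − 1 ≤ ρ²`, `‖e + T‖² = 1 + ‖T‖²`);
  `tangent_feasible_of_active` — activeness + freeness ⇒ `⟪T, w⟫ ≤ ρ‖w‖²‖T‖/4`.
* **`inner_gt_half_of_pair`** (L5) — unit witnesses `u ∈ cone(e, ρ)`, `v ∈ cone(e₂, ρ)`, `u ≠ e`, free for the active blockers, under the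
  two KAPPA hypotheses: `½ < ⟪u, v⟫` (chord `< 1`: the two cone neighbourhoods host at most one witness jointly);
  `norm_sub_lt_one_of_pair`.
* `cone_convex` (PAIR leaves, schema `XNode … "PAIR"`): the corner test `⟪p, e⟫ > 0 ∧ ‖p‖² ≤ (1 + ρ²)⟪p, e⟫²` passes to convex
  combinations and to their unit directions (`unit_mem_cone_of_mem_cone`).
* **`kappa_of_fan`** — a FINITE certificate for the KAPPA hypothesis (19481-w2's shape note 2 on `KappaCert`): a ccw cycle of tangent
  directions `D_0, …, D_{n−1}` at `e` (orientation form `ω` as in '…PinPolygon') whose consecutive sectors are each tagged VIOLATED (the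
  2-corner strict (L2) test against some active blocker cap `(w, ρ‖w‖²/4)`) or GOOD (the 2-corner closed (L2) test against `(e₂ − ½e, κ)`);
  by sector location (`exists_sector_of_ccwCycle`) every tangent `T` is in some sector, so a `ρ`-feasible `T` is in a GOOD one.
Proofs: elementary real-inner-product algebra; the arithmetic core by `nlinarith` from the displayed decomposition
`κx + κ'y > ¾(x² + y²) + x²y²/8 ≥ xy + (x² + y²)/4 + x²y²/8`.
WHAT THIS IS NOT: not the checker; not cf-p2's one-radical candidate enumeration R1(ii) (replaced on the Lean side by the fan certificate);
no statement about types, tables or packings; F-C1 not moved.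
-/

namespace Summit.Ventures.Crystal3D.Theorems

namespace CapChecker

open Finset
open scoped InnerProductSpace

variable {V : Type*} [NormedAddCommGroup V] [InnerProductSpace ℝ V]

/-! ### The real-arithmetic core -/

/-- **(L5), real core.**  For `0 ≤ x, y ≤ ρ` with `x + y > 0` and `κ, κ' > 3ρ/4 + ρ³/16`:
`½ + κx + κ'y − xy > ½(1 + x²/2)(1 + y²/2)` — since `κx + κ'y > (3ρ/4)(x + y) + (ρ³/16)(x + y) ≥ ¾(x² + y²) + x²y²/8` and
`¾(x² + y²) − xy − ¼(x² + y²) = ½(x − y)² ≥ 0`. -/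
theorem pair_arith {ρ κ κ' x y : ℝ} (hρ : 0 < ρ) (hκ : 3 * ρ / 4 + ρ ^ 3 / 16 < κ) (hκ' : 3 * ρ / 4 + ρ ^ 3 / 16 < κ')
    (hx0 : 0 ≤ x) (hxρ : x ≤ ρ) (hy0 : 0 ≤ y) (hyρ : y ≤ ρ) (hxy : 0 < x + y) :
    1 / 2 * ((1 + x ^ 2 / 2) * (1 + y ^ 2 / 2)) < 1 / 2 + κ * x + κ' * y - x * y := by
  -- `κx + κ'y > (3ρ/4 + ρ³/16)(x + y)` (one of `x, y` is positive)
  have h1 : (3 * ρ / 4 + ρ ^ 3 / 16) * (x + y) < κ * x + κ' * y := by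
    have hL : 0 < 3 * ρ / 4 + ρ ^ 3 / 16 := by positivity
    rcases hx0.lt_or_eq with hx | hx
    · nlinarith [mul_lt_mul_of_pos_right hκ hx, mul_le_mul_of_nonneg_right hκ'.le hy0]
    · have hy : 0 < y := by rw [← hx] at hxy; linarith
      nlinarith [mul_lt_mul_of_pos_right hκ' hy, mul_le_mul_of_nonneg_right hκ.le hx0]
  -- `ρx ≥ x²`, `ρy ≥ y²`, `ρ³x ≥ x²y²`, `ρ³y ≥ x²y²`
  have h2 : x ^ 2 ≤ ρ * x := by nlinarith
  have h3 : y ^ 2 ≤ ρ * y := by nlinarith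
  have hxy2 : x * y ≤ ρ * ρ := mul_le_mul hxρ hyρ hy0 hρ.le
  have h4 : x ^ 2 * y ^ 2 ≤ ρ ^ 3 * x := by
    have : x * y ^ 2 ≤ ρ ^ 3 := by nlinarith [mul_le_mul hxρ (mul_le_mul hyρ hyρ hy0 hρ.le) (by positivity) hρ.le]
    nlinarith
  have h5 : x ^ 2 * y ^ 2 ≤ ρ ^ 3 * y := by
    have : x ^ 2 * y ≤ ρ ^ 3 := by nlinarith [mul_le_mul (mul_le_mul hxρ hxρ hx0 hρ.le) hyρ hy0 (by positivity)]
    nlinarith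
  nlinarith [sq_nonneg (x - y)]

/-- `√(1 + x²) ≤ 1 + x²/2`. -/
theorem sqrt_one_add_sq_le (x : ℝ) : Real.sqrt (1 + x ^ 2) ≤ 1 + x ^ 2 / 2 := by
  rw [show (1 + x ^ 2 / 2) = Real.sqrt ((1 + x ^ 2 / 2) ^ 2) from (Real.sqrt_sq (by positivity)).symm]
  exact Real.sqrt_le_sqrt (by nlinarith [sq_nonneg x])

/-- **(L5), real core with the true norms**: under the same hypotheses `½√(1 + x²)√(1 + y²) < ½ + κx + κ'y − xy`. -/
theorem pair_arith_sqrt {ρ κ κ' x y : ℝ} (hρ : 0 < ρ) (hκ : 3 * ρ / 4 + ρ ^ 3 / 16 < κ) (hκ' : 3 * ρ / 4 + ρ ^ 3 / 16 < κ')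
    (hx0 : 0 ≤ x) (hxρ : x ≤ ρ) (hy0 : 0 ≤ y) (hyρ : y ≤ ρ) (hxy : 0 < x + y) :
    1 / 2 * (Real.sqrt (1 + x ^ 2) * Real.sqrt (1 + y ^ 2)) < 1 / 2 + κ * x + κ' * y - x * y := by
  have h := pair_arith hρ hκ hκ' hx0 hxρ hy0 hyρ hxy
  have h1 := sqrt_one_add_sq_le x
  have h2 := sqrt_one_add_sq_le y
  have h3 : Real.sqrt (1 + x ^ 2) * Real.sqrt (1 + y ^ 2) ≤ (1 + x ^ 2 / 2) * (1 + y ^ 2 / 2) :=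
    mul_le_mul h1 h2 (Real.sqrt_nonneg _) (by positivity)
  linarith

/-! ### Gnomonic coordinates at a slot direction -/

/-- **Gnomonic decomposition.**  `e, u` unit with `a = ⟪u, e⟫ > 0`: the gnomonic point `a⁻¹u = e + T` has `T ⊥ e`,
`‖T‖² = a⁻² − 1` and `‖e + T‖² = 1 + ‖T‖²`; inside `cone(e, ρ)` (`1 ≤ (1 + ρ²)a²`) moreover `‖T‖ ≤ ρ`. -/
theorem gnomonic_tangent {e u : V} {ρ : ℝ} (he : ‖e‖ = 1) (hu : ‖u‖ = 1) (ha : 0 < ⟪u, e⟫_ℝ) (hρ : 0 ≤ ρ)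
    (hcone : 1 ≤ (1 + ρ ^ 2) * ⟪u, e⟫_ℝ ^ 2) :
    ⟪(⟪u, e⟫_ℝ)⁻¹ • u - e, e⟫_ℝ = 0 ∧ ‖(⟪u, e⟫_ℝ)⁻¹ • u - e‖ ^ 2 = (⟪u, e⟫_ℝ ^ 2)⁻¹ - 1 ∧
      ‖(⟪u, e⟫_ℝ)⁻¹ • u‖ ^ 2 = 1 + ‖(⟪u, e⟫_ℝ)⁻¹ • u - e‖ ^ 2 ∧ ‖(⟪u, e⟫_ℝ)⁻¹ • u - e‖ ≤ ρ := by
  set a := ⟪u, e⟫_ℝ with ha'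
  have hee : ⟪e, e⟫_ℝ = 1 := by rw [real_inner_self_eq_norm_sq, he, one_pow]
  have huu : ⟪u, u⟫_ℝ = 1 := by rw [real_inner_self_eq_norm_sq, hu, one_pow]
  have heu : ⟪e, u⟫_ℝ = a := real_inner_comm u e
  have h1 : ⟪a⁻¹ • u - e, e⟫_ℝ = 0 := by
    rw [inner_sub_left, real_inner_smul_left, ← ha', hee, inv_mul_cancel₀ ha.ne', sub_self]
  have h2 : ‖a⁻¹ • u - e‖ ^ 2 = (a ^ 2)⁻¹ - 1 := by
    rw [← real_inner_self_eq_norm_sq]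
    simp only [inner_sub_left, inner_sub_right, real_inner_smul_left, real_inner_smul_right, huu, hee, heu, ← ha']
    field_simp
    ring
  have h3 : ‖a⁻¹ • u‖ ^ 2 = 1 + ‖a⁻¹ • u - e‖ ^ 2 := by
    rw [h2, norm_smul, mul_pow, hu, one_pow, mul_one, norm_inv, Real.norm_eq_abs, inv_pow, sq_abs]
    ring
  refine ⟨h1, h2, h3, ?_⟩
  have h4 : ‖a⁻¹ • u - e‖ ^ 2 ≤ ρ ^ 2 := by
    rw [h2]
    have ha2 : 0 < a ^ 2 := by positivity
    rw [sub_le_iff_le_add, inv_le_iff_one_le_mul₀ ha2]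
    linarith
  exact (sq_le_sq₀ (norm_nonneg _) hρ).1 h4

/-- **Tangent feasibility from activeness.**  `e, u` unit, `a = ⟪u, e⟫ > 0`, `T = a⁻¹u − e` with `‖T‖ ≤ ρ`; a blocker `w` active at `e`
(`⟪e, w⟫ = ‖w‖²/2`) and respected by `u` (`⟪u, w⟫ ≤ ‖w‖²/2`).  Then `⟪T, w⟫ ≤ ρ‖w‖²‖T‖/4`
(from `⟪T, w⟫ ≤ (‖w‖²/2)(a⁻¹ − 1)` and `a⁻¹ = √(1 + ‖T‖²) ≤ 1 + ‖T‖²/2`). -/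
theorem tangent_feasible_of_active {e u w : V} {ρ : ℝ} (he : ‖e‖ = 1) (hu : ‖u‖ = 1) (ha : 0 < ⟪u, e⟫_ℝ) (hρ : 0 ≤ ρ)
    (hcone : 1 ≤ (1 + ρ ^ 2) * ⟪u, e⟫_ℝ ^ 2) (hact : ⟪e, w⟫_ℝ = ‖w‖ ^ 2 / 2) (hfree : ⟪u, w⟫_ℝ ≤ ‖w‖ ^ 2 / 2) :
    ⟪(⟪u, e⟫_ℝ)⁻¹ • u - e, w⟫_ℝ ≤ ρ * ‖w‖ ^ 2 / 4 * ‖(⟪u, e⟫_ℝ)⁻¹ • u - e‖ := by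
  obtain ⟨_, h2, h3, h4⟩ := gnomonic_tangent he hu ha hρ hcone
  set a := ⟪u, e⟫_ℝ with ha'
  set T := a⁻¹ • u - e with hT
  set x := ‖T‖ with hx
  have hW : 0 ≤ ‖w‖ ^ 2 / 2 := by positivity
  -- `⟪T, w⟫ ≤ (‖w‖²/2)(a⁻¹ − 1)`
  have h5 : ⟪T, w⟫_ℝ ≤ ‖w‖ ^ 2 / 2 * (a⁻¹ - 1) := by
    have : ⟪T, w⟫_ℝ = a⁻¹ * ⟪u, w⟫_ℝ - ‖w‖ ^ 2 / 2 := by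
      rw [hT, inner_sub_left, real_inner_smul_left, hact]
    rw [this]
    have hai : 0 < a⁻¹ := inv_pos.2 ha
    nlinarith [mul_le_mul_of_nonneg_left hfree hai.le]
  -- `a⁻¹ = ‖a⁻¹ u‖ = √(1 + x²) ≤ 1 + x²/2`
  have h6 : a⁻¹ = Real.sqrt (1 + x ^ 2) := by
    have hn : ‖a⁻¹ • u‖ = a⁻¹ := by
      rw [norm_smul, hu, mul_one, norm_inv, Real.norm_of_nonneg ha.le]
    rw [← hn, ← h3, Real.sqrt_sq (norm_nonneg _)]
  have h7 : a⁻¹ - 1 ≤ x ^ 2 / 2 := by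
    have := sqrt_one_add_sq_le x
    rw [← h6] at this
    linarith
  have h8 : ⟪T, w⟫_ℝ ≤ ‖w‖ ^ 2 / 2 * (x ^ 2 / 2) := h5.trans (mul_le_mul_of_nonneg_left h7 hW)
  have h9 : ‖w‖ ^ 2 / 2 * (x ^ 2 / 2) ≤ ρ * ‖w‖ ^ 2 / 4 * x := by
    have : x * x ≤ ρ * x := mul_le_mul_of_nonneg_right h4 (norm_nonneg _)
    nlinarith [sq_nonneg ‖w‖]
  exact h8.trans h9

/-! ### (L5) The pair rule -/

/-- **(L5) the PAIR rule** (schema v1 S-3 (L5)).  `e, e₂` unit with `⟪e, e₂⟫ = ½`; `ρ > 0`; `κ, κ' > 3ρ/4 + ρ³/16`; `Ae`, `Ae₂` blockers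
active at `e`, resp. `e₂`.  KAPPA hypotheses (support form of CHECK R1, see `kappa_of_fan`): every tangent `T ⊥ e` that is
`ρ`-feasible for `Ae` (`⟪T, w⟫ ≤ ρ‖w‖²‖T‖/4`) has `κ‖T‖ ≤ ⟪T, e₂ − ½e⟫`, and symmetrically at `e₂`.  Then two unit vectors
`u ∈ cone(e, ρ)`, `v ∈ cone(e₂, ρ)` with `u ≠ e`, respecting `Ae` resp. `Ae₂`, satisfy `½ < ⟪u, v⟫` — they cannot both be witnesses. -/
theorem inner_gt_half_of_pair {e e₂ u v : V} {Ae Ae₂ : Set V} {ρ κ κ' : ℝ} (he : ‖e‖ = 1) (he₂ : ‖e₂‖ = 1)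
    (hee₂ : ⟪e, e₂⟫_ℝ = 1 / 2) (hρ : 0 < ρ) (hκ : 3 * ρ / 4 + ρ ^ 3 / 16 < κ) (hκ' : 3 * ρ / 4 + ρ ^ 3 / 16 < κ')
    (hAe : ∀ w ∈ Ae, ⟪e, w⟫_ℝ = ‖w‖ ^ 2 / 2) (hAe₂ : ∀ w ∈ Ae₂, ⟪e₂, w⟫_ℝ = ‖w‖ ^ 2 / 2)
    (hSe : ∀ T : V, ⟪T, e⟫_ℝ = 0 → (∀ w ∈ Ae, ⟪T, w⟫_ℝ ≤ ρ * ‖w‖ ^ 2 / 4 * ‖T‖) →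
      κ * ‖T‖ ≤ ⟪T, e₂ - (1 / 2 : ℝ) • e⟫_ℝ)
    (hSe₂ : ∀ T : V, ⟪T, e₂⟫_ℝ = 0 → (∀ w ∈ Ae₂, ⟪T, w⟫_ℝ ≤ ρ * ‖w‖ ^ 2 / 4 * ‖T‖) →
      κ' * ‖T‖ ≤ ⟪T, e - (1 / 2 : ℝ) • e₂⟫_ℝ)
    (hu : ‖u‖ = 1) (hv : ‖v‖ = 1) (hune : u ≠ e)
    (hucone : 0 < ⟪u, e⟫_ℝ ∧ 1 ≤ (1 + ρ ^ 2) * ⟪u, e⟫_ℝ ^ 2) (hvcone : 0 < ⟪v, e₂⟫_ℝ ∧ 1 ≤ (1 + ρ ^ 2) * ⟪v, e₂⟫_ℝ ^ 2)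
    (hufree : ∀ w ∈ Ae, ⟪u, w⟫_ℝ ≤ ‖w‖ ^ 2 / 2) (hvfree : ∀ w ∈ Ae₂, ⟪v, w⟫_ℝ ≤ ‖w‖ ^ 2 / 2) :
    1 / 2 < ⟪u, v⟫_ℝ := by
  obtain ⟨hTe, hT2, hU2, hTρ⟩ := gnomonic_tangent he hu hucone.1 hρ.le hucone.2
  obtain ⟨hT'e, hT'2, hV2, hT'ρ⟩ := gnomonic_tangent he₂ hv hvcone.1 hρ.le hvcone.2
  set a := ⟪u, e⟫_ℝ with ha
  set b := ⟪v, e₂⟫_ℝ with hb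
  set T := a⁻¹ • u - e with hT
  set T' := b⁻¹ • v - e₂ with hT'
  set x := ‖T‖ with hx
  set y := ‖T'‖ with hy
  -- feasibility of the tangents, hence the KAPPA bounds
  have hfeas : ∀ w ∈ Ae, ⟪T, w⟫_ℝ ≤ ρ * ‖w‖ ^ 2 / 4 * ‖T‖ := fun w hw =>
    tangent_feasible_of_active he hu hucone.1 hρ.le hucone.2 (hAe w hw) (hufree w hw)
  have hfeas' : ∀ w ∈ Ae₂, ⟪T', w⟫_ℝ ≤ ρ * ‖w‖ ^ 2 / 4 * ‖T'‖ := fun w hw =>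
    tangent_feasible_of_active he₂ hv hvcone.1 hρ.le hvcone.2 (hAe₂ w hw) (hvfree w hw)
  have hκT : κ * x ≤ ⟪T, e₂ - (1 / 2 : ℝ) • e⟫_ℝ := hSe T hTe hfeas
  have hκT' : κ' * y ≤ ⟪T', e - (1 / 2 : ℝ) • e₂⟫_ℝ := hSe₂ T' hT'e hfeas'
  -- `x > 0` since `u ≠ e`
  have hxpos : 0 < x := by
    rcases (norm_nonneg T).lt_or_eq with h | h
    · exact h
    · exfalso
      apply hune
      have hT0 : T = 0 := norm_eq_zero.1 h.symm
      have hu' : u = a • e := by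
        have h1 : a⁻¹ • u = e := by rw [← sub_eq_zero, ← hT, hT0]
        rw [← h1, smul_smul, mul_inv_cancel₀ hucone.1.ne', one_smul]
      have ha1 : a = 1 := by
        have h1 := congrArg norm hu'
        rw [norm_smul, he, hu, mul_one, Real.norm_of_nonneg hucone.1.le] at h1
        exact h1.symm
      rw [hu', ha1, one_smul]
  -- expand `⟪e + T, e₂ + T'⟫`
  have hTe₂ : ⟪T, e₂⟫_ℝ = ⟪T, e₂ - (1 / 2 : ℝ) • e⟫_ℝ := by
    have h1 : ⟪T, e₂ - (1 / 2 : ℝ) • e⟫_ℝ = ⟪T, e₂⟫_ℝ - (1 / 2 : ℝ) * ⟪T, e⟫_ℝ := by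
      simp only [inner_sub_right, real_inner_smul_right]
    rw [h1, hTe, mul_zero, sub_zero]
  have heT' : ⟪e, T'⟫_ℝ = ⟪T', e - (1 / 2 : ℝ) • e₂⟫_ℝ := by
    have h1 : ⟪T', e - (1 / 2 : ℝ) • e₂⟫_ℝ = ⟪T', e⟫_ℝ - (1 / 2 : ℝ) * ⟪T', e₂⟫_ℝ := by
      simp only [inner_sub_right, real_inner_smul_right]
    rw [h1, hT'e, mul_zero, sub_zero, real_inner_comm]
  have hTT' : -(x * y) ≤ ⟪T, T'⟫_ℝ := by
    have h := abs_real_inner_le_norm T T'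
    rw [abs_le] at h
    exact h.1
  have hUV : ⟪a⁻¹ • u, b⁻¹ • v⟫_ℝ = 1 / 2 + ⟪T, e₂⟫_ℝ + ⟪e, T'⟫_ℝ + ⟪T, T'⟫_ℝ := by
    have hU : a⁻¹ • u = e + T := by rw [hT]; abel
    have hV : b⁻¹ • v = e₂ + T' := by rw [hT']; abel
    rw [hU, hV, inner_add_left, inner_add_right, inner_add_right, hee₂]
    ring
  have hlow : 1 / 2 + κ * x + κ' * y - x * y ≤ ⟪a⁻¹ • u, b⁻¹ • v⟫_ℝ := by
    rw [hUV, hTe₂, heT']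
    linarith
  -- the norms: `‖a⁻¹u‖ = √(1 + x²)`, `‖b⁻¹v‖ = √(1 + y²)`
  have hnU : ‖a⁻¹ • u‖ = Real.sqrt (1 + x ^ 2) := by rw [← hU2, Real.sqrt_sq (norm_nonneg _)]
  have hnV : ‖b⁻¹ • v‖ = Real.sqrt (1 + y ^ 2) := by rw [← hV2, Real.sqrt_sq (norm_nonneg _)]
  have harith := pair_arith_sqrt hρ hκ hκ' (norm_nonneg T) hTρ (norm_nonneg T') hT'ρ (by linarith [norm_nonneg T'])
  have hkey : 1 / 2 * (‖a⁻¹ • u‖ * ‖b⁻¹ • v‖) < ⟪a⁻¹ • u, b⁻¹ • v⟫_ℝ := by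
    rw [hnU, hnV]; linarith
  -- undo the positive scalings
  have hnU' : ‖a⁻¹ • u‖ = a⁻¹ := by rw [norm_smul, hu, mul_one, norm_inv, Real.norm_of_nonneg hucone.1.le]
  have hnV' : ‖b⁻¹ • v‖ = b⁻¹ := by rw [norm_smul, hv, mul_one, norm_inv, Real.norm_of_nonneg hvcone.1.le]
  rw [hnU', hnV', real_inner_smul_left, real_inner_smul_right] at hkey
  have hab : 0 < a⁻¹ * b⁻¹ := mul_pos (inv_pos.2 hucone.1) (inv_pos.2 hvcone.1)
  have : a⁻¹ * b⁻¹ * (1 / 2) < a⁻¹ * b⁻¹ * ⟪u, v⟫_ℝ := by nlinarith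
  exact lt_of_mul_lt_mul_left this hab.le

/-- **(L5), chord form**: under the hypotheses of `inner_gt_half_of_pair` the two unit vectors are at chord distance `< 1`. -/
theorem norm_sub_lt_one_of_pair {e e₂ u v : V} {Ae Ae₂ : Set V} {ρ κ κ' : ℝ} (he : ‖e‖ = 1) (he₂ : ‖e₂‖ = 1)
    (hee₂ : ⟪e, e₂⟫_ℝ = 1 / 2) (hρ : 0 < ρ) (hκ : 3 * ρ / 4 + ρ ^ 3 / 16 < κ) (hκ' : 3 * ρ / 4 + ρ ^ 3 / 16 < κ')
    (hAe : ∀ w ∈ Ae, ⟪e, w⟫_ℝ = ‖w‖ ^ 2 / 2) (hAe₂ : ∀ w ∈ Ae₂, ⟪e₂, w⟫_ℝ = ‖w‖ ^ 2 / 2)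
    (hSe : ∀ T : V, ⟪T, e⟫_ℝ = 0 → (∀ w ∈ Ae, ⟪T, w⟫_ℝ ≤ ρ * ‖w‖ ^ 2 / 4 * ‖T‖) →
      κ * ‖T‖ ≤ ⟪T, e₂ - (1 / 2 : ℝ) • e⟫_ℝ)
    (hSe₂ : ∀ T : V, ⟪T, e₂⟫_ℝ = 0 → (∀ w ∈ Ae₂, ⟪T, w⟫_ℝ ≤ ρ * ‖w‖ ^ 2 / 4 * ‖T‖) →
      κ' * ‖T‖ ≤ ⟪T, e - (1 / 2 : ℝ) • e₂⟫_ℝ)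
    (hu : ‖u‖ = 1) (hv : ‖v‖ = 1) (hune : u ≠ e)
    (hucone : 0 < ⟪u, e⟫_ℝ ∧ 1 ≤ (1 + ρ ^ 2) * ⟪u, e⟫_ℝ ^ 2) (hvcone : 0 < ⟪v, e₂⟫_ℝ ∧ 1 ≤ (1 + ρ ^ 2) * ⟪v, e₂⟫_ℝ ^ 2)
    (hufree : ∀ w ∈ Ae, ⟪u, w⟫_ℝ ≤ ‖w‖ ^ 2 / 2) (hvfree : ∀ w ∈ Ae₂, ⟪v, w⟫_ℝ ≤ ‖w‖ ^ 2 / 2) : ‖u - v‖ < 1 :=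
  (norm_sub_lt_one_iff hu hv).2
    (inner_gt_half_of_pair he he₂ hee₂ hρ hκ hκ' hAe hAe₂ hSe hSe₂ hu hv hune hucone hvcone hufree hvfree)

/-! ### Cones are convex (PAIR leaves) -/

section Cone

variable {ι : Type*}

/-- **Cone corner test passes to the cell.**  If every corner satisfies `0 < ⟪p_i, e⟫` and `‖p_i‖² ≤ (1 + ρ²)⟪p_i, e⟫²` then so does
every convex combination (the second-order cone is convex: `‖·‖ ≤ √(1 + ρ²)⟪·, e⟫` is superadditive). -/
theorem cone_convex {s : Finset ι} {w : ι → ℝ} {p : ι → V} {e : V} {ρ : ℝ}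
    (hw0 : ∀ i ∈ s, 0 ≤ w i) (hw1 : ∑ i ∈ s, w i = 1)
    (hcone : ∀ i ∈ s, 0 < ⟪p i, e⟫_ℝ ∧ ‖p i‖ ^ 2 ≤ (1 + ρ ^ 2) * ⟪p i, e⟫_ℝ ^ 2) :
    0 < ⟪∑ i ∈ s, w i • p i, e⟫_ℝ ∧ ‖∑ i ∈ s, w i • p i‖ ^ 2 ≤ (1 + ρ ^ 2) * ⟪∑ i ∈ s, w i • p i, e⟫_ℝ ^ 2 := by
  set S := Real.sqrt (1 + ρ ^ 2) with hS
  have hS2 : S ^ 2 = 1 + ρ ^ 2 := Real.sq_sqrt (by positivity)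
  have hS0 : 0 ≤ S := Real.sqrt_nonneg _
  -- per corner: `‖p i‖ ≤ S ⟪p i, e⟫`
  have hc : ∀ i ∈ s, ‖p i‖ ≤ S * ⟪p i, e⟫_ℝ := by
    intro i hi
    have h := (hcone i hi).2
    rw [← hS2, ← mul_pow] at h
    exact (sq_le_sq₀ (norm_nonneg _) (mul_nonneg hS0 (hcone i hi).1.le)).1 h
  have hpos : 0 < ⟪∑ i ∈ s, w i • p i, e⟫_ℝ := by
    have hs : ∃ i ∈ s, 0 < w i := by
      by_contra h
      push Not at h
      have : ∑ i ∈ s, w i ≤ 0 := Finset.sum_nonpos h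
      linarith
    obtain ⟨i₀, hi₀, hwi₀⟩ := hs
    rw [sum_inner]
    simp_rw [real_inner_smul_left]
    exact Finset.sum_pos' (fun i hi => mul_nonneg (hw0 i hi) (hcone i hi).1.le)
      ⟨i₀, hi₀, mul_pos hwi₀ (hcone i₀ hi₀).1⟩
  refine ⟨hpos, ?_⟩
  have hle : ‖∑ i ∈ s, w i • p i‖ ≤ S * ⟪∑ i ∈ s, w i • p i, e⟫_ℝ := by
    calc ‖∑ i ∈ s, w i • p i‖ ≤ ∑ i ∈ s, ‖w i • p i‖ := norm_sum_le _ _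
      _ = ∑ i ∈ s, w i * ‖p i‖ :=
          Finset.sum_congr rfl fun i hi => by rw [norm_smul, Real.norm_of_nonneg (hw0 i hi)]
      _ ≤ ∑ i ∈ s, w i * (S * ⟪p i, e⟫_ℝ) :=
          Finset.sum_le_sum fun i hi => mul_le_mul_of_nonneg_left (hc i hi) (hw0 i hi)
      _ = S * ⟪∑ i ∈ s, w i • p i, e⟫_ℝ := by
          rw [sum_inner, Finset.mul_sum]
          exact Finset.sum_congr rfl fun i _ => by rw [real_inner_smul_left]; ring
  have h := pow_le_pow_left₀ (norm_nonneg _) hle 2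
  rw [mul_pow, hS2] at h
  exact h

/-- **Unit directions of a cone cell are in the cone**: from `0 < ⟪v, e⟫`, `‖v‖² ≤ (1 + ρ²)⟪v, e⟫²` the unit direction `‖v‖⁻¹v`
satisfies `0 < ⟪‖v‖⁻¹v, e⟫` and `1 ≤ (1 + ρ²)⟪‖v‖⁻¹v, e⟫²` (the hypothesis shape of `inner_gt_half_of_pair`). -/
theorem unit_mem_cone_of_mem_cone {v e : V} {ρ : ℝ} (hpos : 0 < ⟪v, e⟫_ℝ) (hcone : ‖v‖ ^ 2 ≤ (1 + ρ ^ 2) * ⟪v, e⟫_ℝ ^ 2) :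
    0 < ⟪‖v‖⁻¹ • v, e⟫_ℝ ∧ 1 ≤ (1 + ρ ^ 2) * ⟪‖v‖⁻¹ • v, e⟫_ℝ ^ 2 := by
  have hv : v ≠ 0 := ne_zero_of_inner_pos hpos
  have hn : 0 < ‖v‖ := norm_pos_iff.2 hv
  rw [real_inner_smul_left]
  refine ⟨mul_pos (inv_pos.2 hn) hpos, ?_⟩
  rw [mul_pow, inv_pow]
  have hn2 : 0 < ‖v‖ ^ 2 := by positivity
  rw [← mul_le_mul_iff_of_pos_left hn2]
  calc ‖v‖ ^ 2 * 1 = ‖v‖ ^ 2 := mul_one _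
    _ ≤ (1 + ρ ^ 2) * ⟪v, e⟫_ℝ ^ 2 := hcone
    _ = ‖v‖ ^ 2 * ((1 + ρ ^ 2) * ((‖v‖ ^ 2)⁻¹ * ⟪v, e⟫_ℝ ^ 2)) := by
        field_simp

end Cone

/-! ### The fan certificate for the KAPPA hypothesis -/

/-- **Two-corner bounds.**  For `v = αp + βq` with `α, β ≥ 0`: corner lower bounds `m ≤ ⟪p, c⟫, ⟪q, c⟫` give `(α + β)m ≤ ⟪v, c⟫`, and
corner norm bounds `‖p‖², ‖q‖² ≤ M` give `‖v‖² ≤ (α + β)²M`. -/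
theorem twoCorner_bounds {p q c : V} {α β m M : ℝ} (hα : 0 ≤ α) (hβ : 0 ≤ β) (hmp : m ≤ ⟪p, c⟫_ℝ) (hmq : m ≤ ⟪q, c⟫_ℝ)
    (hMp : ‖p‖ ^ 2 ≤ M) (hMq : ‖q‖ ^ 2 ≤ M) :
    (α + β) * m ≤ ⟪α • p + β • q, c⟫_ℝ ∧ ‖α • p + β • q‖ ^ 2 ≤ (α + β) ^ 2 * M := by
  refine ⟨?_, ?_⟩
  · rw [inner_add_left, real_inner_smul_left, real_inner_smul_left]
    nlinarith [mul_le_mul_of_nonneg_left hmp hα, mul_le_mul_of_nonneg_left hmq hβ]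
  · have hM0 : 0 ≤ M := (sq_nonneg _).trans hMp
    have hR : ∀ r : V, ‖r‖ ^ 2 ≤ M → ‖r‖ ≤ Real.sqrt M := fun r hr => (Real.le_sqrt (norm_nonneg _) hM0).2 hr
    have h1 : ‖α • p + β • q‖ ≤ (α + β) * Real.sqrt M := by
      calc ‖α • p + β • q‖ ≤ ‖α • p‖ + ‖β • q‖ := norm_add_le _ _
        _ = α * ‖p‖ + β * ‖q‖ := by rw [norm_smul, norm_smul, Real.norm_of_nonneg hα, Real.norm_of_nonneg hβ]
        _ ≤ α * Real.sqrt M + β * Real.sqrt M :=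
            add_le_add (mul_le_mul_of_nonneg_left (hR p hMp) hα) (mul_le_mul_of_nonneg_left (hR q hMq) hβ)
        _ = (α + β) * Real.sqrt M := by ring
    have h2 := pow_le_pow_left₀ (norm_nonneg _) h1 2
    rw [mul_pow, Real.sq_sqrt hM0] at h2
    exact h2

/-- **KAPPA from a fan certificate.**  `D : ℕ → V` a ccw cycle (period `n > 0`, orientation form `ω` with the three-term relation against
tangent vectors at `e`, as in '…PinPolygon'); every consecutive sector `[D i, D (i+1)]` is tagged either VIOLATED — some active blocker
`w ∈ A` and rationals `0 < m ≤ ⟪D i, w⟫, ⟪D (i+1), w⟫`, `‖D i‖², ‖D (i+1)‖² ≤ M`, `(ρ‖w‖²/4)²M < m²` (strict 2-corner (L2) test: every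
direction of the sector violates `⟪·, w⟫ ≤ ρ‖w‖²/4`) — or GOOD — `0 < m ≤ ⟪D i, b⟫, ⟪D (i+1), b⟫`, norms `≤ M`, `κ²M ≤ m²` (closed
2-corner test against `(b, κ)`).  Then every tangent `T ⊥ e` that is `ρ`-feasible for `A` satisfies `κ‖T‖ ≤ ⟪T, b⟫` — the KAPPA
hypothesis of `inner_gt_half_of_pair` with `b = e₂ − ½e`. -/
theorem kappa_of_fan {e b : V} {n : ℕ} (hn : 0 < n) {D : ℕ → V} (hper : ∀ i, D (i + n) = D i)
    {ω : V → V → ℝ} (halt : ∀ x y, ω x y = -ω y x)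
    (hpl : ∀ T : V, ⟪T, e⟫_ℝ = 0 → ∀ i, ω (D i) (D (i + 1)) • T + ω (D (i + 1)) T • D i + ω T (D i) • D (i + 1) = 0)
    (hccw : ∀ i < n, 0 < ω (D i) (D (i + 1))) {A : Set V} {ρ κ : ℝ}
    (htag : ∀ i < n,
      (∃ w ∈ A, ∃ m M : ℝ, 0 < m ∧ m ≤ ⟪D i, w⟫_ℝ ∧ m ≤ ⟪D (i + 1), w⟫_ℝ ∧ ‖D i‖ ^ 2 ≤ M ∧ ‖D (i + 1)‖ ^ 2 ≤ M ∧
          (ρ * ‖w‖ ^ 2 / 4) ^ 2 * M < m ^ 2) ∨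
        (∃ m M : ℝ, 0 < m ∧ m ≤ ⟪D i, b⟫_ℝ ∧ m ≤ ⟪D (i + 1), b⟫_ℝ ∧ ‖D i‖ ^ 2 ≤ M ∧ ‖D (i + 1)‖ ^ 2 ≤ M ∧
          κ ^ 2 * M ≤ m ^ 2))
    {T : V} (hTe : ⟪T, e⟫_ℝ = 0) (hfeas : ∀ w ∈ A, ⟪T, w⟫_ℝ ≤ ρ * ‖w‖ ^ 2 / 4 * ‖T‖) :
    κ * ‖T‖ ≤ ⟪T, b⟫_ℝ := by
  by_cases hT0 : T = 0
  · rw [hT0, norm_zero, mul_zero, inner_zero_left]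
  obtain ⟨i, hi, α, β, hα0, hβ0, hσ, hTαβ⟩ := exists_sector_of_ccwCycle hn hper halt (hpl T hTe) hccw hT0
  rcases htag i hi with ⟨w, hwA, m, M, hm0, hmp, hmq, hMp, hMq, htest⟩ | ⟨m, M, hm0, hmp, hmq, hMp, hMq, htest⟩
  · -- VIOLATED sector: contradiction with feasibility
    exfalso
    obtain ⟨h1, h2⟩ := twoCorner_bounds hα0 hβ0 hmp hmq hMp hMq
    rw [← hTαβ] at h1 h2
    have hlt : ρ * ‖w‖ ^ 2 / 4 * ‖T‖ < ⟪T, w⟫_ℝ :=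
      mul_norm_lt_inner_of_sq_test (mul_pos hσ hm0) h1 h2 (by nlinarith [mul_pos hσ hσ])
    linarith [hfeas w hwA]
  · -- GOOD sector
    obtain ⟨h1, h2⟩ := twoCorner_bounds hα0 hβ0 hmp hmq hMp hMq
    rw [← hTαβ] at h1 h2
    exact mul_norm_le_inner_of_sq_test (mul_pos hσ hm0) h1 h2 (by nlinarith [mul_pos hσ hσ])

end CapChecker

end Summit.Ventures.Crystal3D.Theorems
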